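import Summits.QuantumAdvantage.QuantumAdvantage.Theses.StickelbergerGrid

/-!
# QuantumAdvantage / StickelbergerGrid — `GaussPowerIntegral` (stmt-QuantumAdvantage-17351)

The QUANTIZATION LEMMA of route StickelbergerGrid, PROVED. For valid `(p, ℓ, r)` — `p, ℓ` prime,
`ℓ` odd, `ℓ ∣ p − 1`, `r < p` with `r^ℓ ≡ 1`, `r ≢ 1 (mod p)` — put `n = (p−1)/ℓ`, `ζ = e^{2πi/ℓ}`
and
`S = Σ_{x=1}^{p−1} Σ_{j<ℓ} [r^j ≡ x^n (mod p)] · e^{2πi (j/ℓ + x/p)}`.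
Then `S^ℓ = Σ_{j < ℓ−1} a_j ζ^j` with `a_j ∈ ℤ`, and `‖S‖² = p`.

Proof. `r̄ = (r mod p)` is a primitive `ℓ`-th root of unity in `𝔽_p`, and for every `x ∈ 𝔽_pˣ`
the element `x^n` is an `ℓ`-th root of unity, `= r̄^j` for exactly one `j < ℓ`; so the inner sum is
the single term `ζ^{j(x)} e^{2πi x/p} = χ(x) ψ(x)`, where `ψ` is the standard additive character of
`ℤ/p` (Mathlib `ZMod.stdAddChar`) and `χ` is the multiplicative character of order `ℓ` with
`χ(x) = ζ^j ⟺ x^n = r̄^j` — realised as `MulChar.ofRootOfUnity` sending a generator `g` of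
`𝔽_pˣ` to `ζ^{a'}`, where `r̄ = (g^n)^a` and `a a' ≡ 1 (mod ℓ)`. Hence `S = g(χ, ψ)` is a GAUSS
SUM, and Mathlib gives `g(χ,ψ)^ℓ = χ(−1) · p · ∏_{i=1}^{ℓ−2} J(χ, χ^i)`
(`gaussSum_pow_eq_prod_jacobiSum`), `χ(−1) = 1` (`n` is even), `J(χ, χ^i) ∈ ℤ[ζ]`
(`jacobiSum_mem_algebraAdjoin_of_pow_eq_one`) — so `S^ℓ ∈ ℤ[ζ]`, and every element of `ℤ[ζ]` is
`Σ_{j<ℓ−1} a_j ζ^j` (reduce a polynomial in `ζ` modulo the cyclotomic polynomial `Φ_ℓ`, of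
degree `ℓ − 1`, `Φ_ℓ(ζ) = 0`); and `‖S‖² = S·S̄ = g(χ,ψ) g(χ̄, ψ̄) = p`
(`star_gaussSum_eq`, `gaussSum_mul_gaussSum_eq_card`).

HONEST FRAMING (block-2b rule): the value here is a closed ledger item (a classical lemma,
kernel-checked), not summit progress.

References: K. Ireland, M. Rosen, *A Classical Introduction to Modern Number Theory*, GTM 84
(1990), Ch. 8 §§2–3, Prop. 8.3.3 and its corollary (`g(χ)^ℓ = χ(−1) p ∏ J(χ,χ^i) ∈ ℤ[ζ]`)
[IrelandRosen1990]; L. C. Washington, *Introduction to Cyclotomic Fields*, GTM 83 (1997), §6.1,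
Lemma 6.1 [Washington1997]; Mathlib `Mathlib.NumberTheory.GaussSum`,
`Mathlib.NumberTheory.JacobiSum.Basic`.
-/

set_option linter.dupNamespace false -- D-0017: single-problem summit ⇒ `QuantumAdvantage.QuantumAdvantage` by design

namespace Summit.QuantumAdvantage.QuantumAdvantage.Theorems.GaussPowerIntegral

open Finset Polynomial

/-! ### `ℤ[ζ]` has the normal form `Σ_{j<ℓ−1} a_j ζ^j` -/

/-- For a primitive `ℓ`-th root of unity `ζ` in `ℂ` (`ℓ` prime), every element of
`ℤ[ζ] = Algebra.adjoin ℤ {ζ}` is an integer combination of `1, ζ, …, ζ^{ℓ−2}` (reduction of a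
polynomial modulo the cyclotomic polynomial `Φ_ℓ`, monic of degree `ℓ − 1` with `Φ_ℓ(ζ) = 0`).
[Washington 1997, Prop. 2.16 / §1] [folklore] -/
theorem nf_of_mem_adjoin {ℓ : ℕ} (hℓ : ℓ.Prime) {ζ : ℂ} (hζ : IsPrimitiveRoot ζ ℓ) {z : ℂ}
    (hz : z ∈ Algebra.adjoin ℤ ({ζ} : Set ℂ)) :
    ∃ a : Fin (ℓ - 1) → ℤ, z = ∑ j : Fin (ℓ - 1), ((a j : ℤ) : ℂ) * ζ ^ (j.val) := by
  rw [Algebra.adjoin_singleton_eq_range_aeval, AlgHom.mem_range] at hz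
  obtain ⟨q, rfl⟩ := hz
  have hℓ2 : 2 ≤ ℓ := hℓ.two_le
  set Φ : ℤ[X] := cyclotomic ℓ ℤ with hΦ
  have hmonic : Φ.Monic := cyclotomic.monic ℓ ℤ
  have hdeg : Φ.natDegree = ℓ - 1 := by
    rw [hΦ, natDegree_cyclotomic, Nat.totient_prime hℓ]
  have hroot : aeval ζ Φ = 0 := by
    have h := hζ.isRoot_cyclotomic hℓ.pos
    rw [IsRoot.def, ← map_cyclotomic_int ℓ ℂ, eval_map, ← algebraMap_int_eq, ← aeval_def] at h
    exact h
  have hΦ1 : Φ ≠ 1 := by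
    intro h
    have := congrArg natDegree h
    rw [hdeg, natDegree_one] at this
    omega
  -- reduce modulo Φ
  have hq : aeval ζ q = aeval ζ (q %ₘ Φ) := by
    conv_lhs => rw [← modByMonic_add_div q Φ]
    rw [map_add, map_mul, hroot, zero_mul, add_zero]
  have hlt : (q %ₘ Φ).natDegree < ℓ - 1 := by
    rw [← hdeg]
    exact natDegree_modByMonic_lt q hmonic hΦ1
  refine ⟨fun j => (q %ₘ Φ).coeff j.val, ?_⟩
  rw [hq, aeval_eq_sum_range' hlt, Finset.sum_range]
  refine Finset.sum_congr rfl fun j _ => ?_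
  rw [zsmul_eq_mul]

/-! ### Small facts -/

/-- `u^s = u^(s mod ℓ)` when `u^ℓ = 1`. [folklore] -/
theorem pow_eq_pow_mod {M : Type*} [Monoid M] {u : M} {ℓ : ℕ} (hu : u ^ ℓ = 1) (s : ℕ) :
    u ^ s = u ^ (s % ℓ) := by
  conv_lhs => rw [← Nat.div_add_mod s ℓ, pow_add, pow_mul, hu, one_pow, one_mul]

/-- The standard additive character on a natural number: `ψ(x) = e^{2πi x/p}`. [folklore] -/
theorem stdAddChar_natCast {N : ℕ} [NeZero N] (x : ℕ) :
    ZMod.stdAddChar (x : ZMod N) = Complex.exp (2 * Real.pi * Complex.I * x / N) := by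
  have h := ZMod.stdAddChar_coe (N := N) (x : ℤ)
  push_cast at h
  exact h

/-- Re-indexing a sum over `ZMod p` by `{0, …, p−1}`. [folklore] -/
theorem sum_zmod_eq_sum_range {p : ℕ} [NeZero p] {M : Type*} [AddCommMonoid M] (f : ZMod p → M) :
    ∑ y : ZMod p, f y = ∑ x ∈ Finset.range p, f (x : ZMod p) := by
  symm
  refine Finset.sum_nbij' (fun x : ℕ => (x : ZMod p)) (fun y : ZMod p => y.val) (fun _ _ => mem_univ _)
    (fun y _ => Finset.mem_range.2 (ZMod.val_lt y)) (fun x hx => ?_) (fun y _ => ZMod.natCast_zmod_val y)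
    (fun _ _ => rfl)
  rw [Finset.mem_range] at hx
  rw [ZMod.val_natCast, Nat.mod_eq_of_lt hx]

/-! ### The theorem -/

/-- **`GaussPowerIntegral`** (stmt-QuantumAdvantage-17351): for valid `(p, ℓ, r)` the sum
`S = Σ_{x=1}^{p−1} Σ_{j<ℓ} [r^j ≡ x^{(p−1)/ℓ} (mod p)] e^{2πi(j/ℓ + x/p)}` is the Gauss sum of a
character of order `ℓ`, `S^ℓ = Σ_{j<ℓ−1} a_j ζ_ℓ^j` with `a_j ∈ ℤ`, and `‖S‖² = p`.
[Ireland–Rosen 1990, Prop. 8.3.3 and Cor.; Washington 1997, Lemma 6.1] -/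
theorem gaussPowerIntegral_proof :
    Summit.QuantumAdvantage.QuantumAdvantage.Theses.StickelbergerGrid.GaussPowerIntegral := by
  unfold Summit.QuantumAdvantage.QuantumAdvantage.Theses.StickelbergerGrid.GaussPowerIntegral
  rintro p ℓ r ⟨hp, hℓ, hodd, hdiv, hrp, hrℓ, hr1⟩
  classical
  haveI hpF : Fact p.Prime := ⟨hp⟩
  haveI hℓF : Fact ℓ.Prime := ⟨hℓ⟩
  -- numerics
  have hℓ3 : 3 ≤ ℓ := by
    have h2 := hℓ.two_le
    rcases hodd with ⟨k, hk⟩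
    omega
  obtain ⟨n, hn⟩ : ∃ n, p - 1 = ℓ * n := hdiv
  have hp2 := hp.two_le
  have hn0 : 0 < n := by
    rcases Nat.eq_zero_or_pos n with h | h
    · rw [h, mul_zero] at hn; omega
    · exact h
  have hndef : (p - 1) / ℓ = n := by
    rw [hn, Nat.mul_div_cancel_left _ hℓ.pos]
  have hp3 : 3 ≤ p := by
    have h1 : 3 ≤ ℓ * n := le_trans hℓ3 (Nat.le_mul_of_pos_right _ hn0)
    omega
  have hneven : Even n := by
    have hpodd : p % 2 = 1 := Nat.odd_iff.1 (hp.odd_of_ne_two (by omega))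
    obtain ⟨k, hk⟩ := hodd
    rcases Nat.even_or_odd n with h | ⟨m, hm⟩
    · exact h
    · exfalso
      rw [hk, hm] at hn
      have : (p - 1) % 2 = 0 := by omega
      rw [hn] at this
      ring_nf at this
      omega
  rw [hndef]
  -- `ζ = e^{2πi/ℓ}`
  set ζ : ℂ := Complex.exp (2 * Real.pi * Complex.I / ℓ) with hζ_def
  have hζ : IsPrimitiveRoot ζ ℓ := Complex.isPrimitiveRoot_exp ℓ hℓ.ne_zero
  have hζℓ : ζ ^ ℓ = 1 := hζ.pow_eq_one
  -- `r̄` is a primitive `ℓ`-th root of unity in `𝔽_p`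
  set rb : ZMod p := (r : ZMod p) with hrb_def
  have hrbℓ : rb ^ ℓ = 1 := by
    have h : ((r ^ ℓ : ℕ) : ZMod p) = ((1 : ℕ) : ZMod p) := by
      rw [ZMod.natCast_eq_natCast_iff', hrℓ, Nat.mod_eq_of_lt hp.one_lt]
    rw [Nat.cast_pow, Nat.cast_one] at h
    exact h
  have hrb1 : rb ≠ 1 := by
    intro h
    have h' : ((r : ℕ) : ZMod p) = ((1 : ℕ) : ZMod p) := by rw [Nat.cast_one]; exact h
    rw [ZMod.natCast_eq_natCast_iff', Nat.mod_eq_of_lt hp.one_lt] at h'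
    exact hr1 h'
  have hrbprim : IsPrimitiveRoot rb ℓ := by
    rw [← orderOf_eq_prime hrbℓ hrb1]
    exact IsPrimitiveRoot.orderOf rb
  -- a generator `g` of `𝔽_pˣ`, `ρ = g^n`
  obtain ⟨g, hg⟩ := IsCyclic.exists_generator (α := (ZMod p)ˣ)
  have hcard : Fintype.card (ZMod p)ˣ = p - 1 := ZMod.card_units p
  have horder : orderOf g = p - 1 := by
    rw [orderOf_eq_card_of_forall_mem_zpowers hg, Nat.card_eq_fintype_card, hcard]
  have hg0 : (g : ZMod p) ≠ 0 := Units.ne_zero g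
  set ρ : ZMod p := (g : ZMod p) ^ n with hρ_def
  clear_value ρ
  have hρℓ : ρ ^ ℓ = 1 := by
    rw [hρ_def, ← pow_mul, mul_comm, ← hn]
    exact ZMod.pow_card_sub_one_eq_one hg0
  have hρ1 : ρ ≠ 1 := by
    intro h
    have hu : g ^ n = 1 := Units.ext (by rw [Units.val_pow_eq_pow_val, Units.val_one, ← hρ_def]; exact h)
    refine pow_ne_one_of_lt_orderOf hn0.ne' ?_ hu
    rw [horder, hn]
    nlinarith
  have hρprim : IsPrimitiveRoot ρ ℓ := by
    rw [← orderOf_eq_prime hρℓ hρ1]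
    exact IsPrimitiveRoot.orderOf ρ
  -- `r̄ = ρ^a`, `a a' ≡ 1 (mod ℓ)`
  haveI : NeZero ℓ := ⟨hℓ.ne_zero⟩
  obtain ⟨a, haℓ, hra⟩ := hρprim.eq_pow_of_pow_eq_one hrbℓ
  have ha0 : (a : ZMod ℓ) ≠ 0 := by
    intro h
    rw [ZMod.natCast_eq_zero_iff] at h
    have : a = 0 := Nat.eq_zero_of_dvd_of_lt h haℓ
    rw [this, pow_zero] at hra
    exact hrb1 hra.symm
  set a' : ℕ := ((a : ZMod ℓ)⁻¹).val with ha'_def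
  have haa' : (a * a') % ℓ = 1 := by
    have h : ((a * a' : ℕ) : ZMod ℓ) = ((1 : ℕ) : ZMod ℓ) := by
      rw [Nat.cast_mul, ha'_def, ZMod.natCast_zmod_val, mul_inv_cancel₀ ha0, Nat.cast_one]
    rw [ZMod.natCast_eq_natCast_iff', Nat.mod_eq_of_lt hℓ.one_lt] at h
    exact h
  -- the character `χ` of order `ℓ` with `χ(g) = ζ^{a'}`
  set ζu : ℂˣ := ((hζ.isUnit hℓ.ne_zero).unit) ^ a' with hζu_def
  have hζu_val : (ζu : ℂ) = ζ ^ a' := by rw [hζu_def, Units.val_pow_eq_pow_val]; rfl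
  have hζu : ζu ∈ rootsOfUnity (Fintype.card (ZMod p)ˣ) ℂ := by
    rw [mem_rootsOfUnity', hcard, hζu_val, hn, ← pow_mul, mul_comm a', mul_assoc, pow_mul, hζℓ,
      one_pow]
  set χ : MulChar (ZMod p) ℂ := MulChar.ofRootOfUnity hζu hg with hχ_def
  have hχg : χ (g : ZMod p) = ζ ^ a' := by
    rw [hχ_def, MulChar.ofRootOfUnity_spec hζu hg, hζu_val]
  -- discrete logarithms: `χ x = ζ^j` and `x^n = r̄^j` with the same `j < ℓ`
  have hlog : ∀ x : ZMod p, x ≠ 0 → ∃ j : ℕ, j < ℓ ∧ χ x = ζ ^ j ∧ x ^ n = rb ^ j := by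
    intro x hx
    obtain ⟨m, hm⟩ := (Submonoid.mem_powers_iff _ _).1
      (((isOfFinOrder_of_finite g).mem_powers_iff_mem_zpowers).2 (hg (Units.mk0 x hx)))
    have hxm : x = ((g ^ m : (ZMod p)ˣ) : ZMod p) := by rw [hm]; rfl
    refine ⟨(a' * m) % ℓ, Nat.mod_lt _ hℓ.pos, ?_, ?_⟩
    · rw [hxm, Units.val_pow_eq_pow_val, map_pow, hχg, ← pow_mul, pow_eq_pow_mod hζℓ]
    · rw [hxm, Units.val_pow_eq_pow_val]
      calc ((g : ZMod p) ^ m) ^ n = ρ ^ m := by rw [← pow_mul, mul_comm, pow_mul, hρ_def]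
        _ = (ρ ^ a) ^ (a' * m) := by
            rw [← pow_mul, pow_eq_pow_mod hρℓ m, pow_eq_pow_mod hρℓ (a * (a' * m))]
            congr 1
            symm
            rw [← mul_assoc, Nat.mul_mod, haa', one_mul, Nat.mod_mod]
        _ = rb ^ (a' * m % ℓ) := by rw [hra, ← pow_eq_pow_mod hrbℓ]
  have huniq : ∀ x : ZMod p, ∀ j j' : ℕ, j < ℓ → j' < ℓ → x ^ n = rb ^ j → x ^ n = rb ^ j' →
      j = j' := by
    intro x j j' hj hj' h1 h2
    exact hrbprim.pow_inj hj hj' (h1.symm.trans h2)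
  -- `χ` is nontrivial of order `ℓ`, `χ(−1) = 1`
  have hζa'1 : ζ ^ a' ≠ 1 := by
    intro h
    have hdvd := (hζ.pow_eq_one_iff_dvd a').1 h
    have : (a * a') % ℓ = 0 := Nat.mod_eq_zero_of_dvd (dvd_mul_of_dvd_right hdvd a)
    omega
  have hχ1 : χ ≠ 1 := by
    rw [Ne, MulChar.eq_iff hg, hχg, MulChar.one_apply_coe]
    exact hζa'1
  have hχℓ : χ ^ ℓ = 1 := by
    rw [MulChar.eq_iff hg, MulChar.pow_apply_coe, hχg, MulChar.one_apply_coe, ← pow_mul, mul_comm,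
      pow_mul, hζℓ, one_pow]
  have hordχ : orderOf χ = ℓ := orderOf_eq_prime hχℓ hχ1
  have hχneg : χ (-1) = 1 := by
    obtain ⟨j, hj, hχj, hnj⟩ := hlog (-1) (by rw [Ne, neg_eq_zero]; exact one_ne_zero)
    have h0 : (-1 : ZMod p) ^ n = rb ^ 0 := by rw [hneven.neg_one_pow, pow_zero]
    rw [hχj, huniq (-1) j 0 hj hℓ.pos hnj h0, pow_zero]
  -- the inner sum is `χ(x) ψ(x)`
  set ψ : AddChar (ZMod p) ℂ := ZMod.stdAddChar with hψ_def
  have hψprim : ψ.IsPrimitive := ZMod.isPrimitive_stdAddChar p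
  have hinner : ∀ x ∈ Finset.Icc 1 (p - 1),
      (∑ j ∈ Finset.range ℓ, if r ^ j % p = x ^ n % p then
        Complex.exp (2 * Real.pi * Complex.I * ((j : ℂ) / (ℓ : ℂ) + (x : ℂ) / (p : ℂ))) else 0) =
      χ (x : ZMod p) * ψ (x : ZMod p) := by
    intro x hx
    rw [Finset.mem_Icc] at hx
    have hx0 : (x : ZMod p) ≠ 0 := by
      rw [Ne, ZMod.natCast_eq_zero_iff]
      exact Nat.not_dvd_of_pos_of_lt (by omega) (by omega)
    obtain ⟨j₀, hj₀, hχx, hxn⟩ := hlog (x : ZMod p) hx0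
    have hcond : ∀ j : ℕ, j < ℓ → (r ^ j % p = x ^ n % p ↔ j = j₀) := by
      intro j hj
      rw [← ZMod.natCast_eq_natCast_iff', Nat.cast_pow, Nat.cast_pow]
      constructor
      · intro h
        exact huniq (x : ZMod p) j j₀ hj hj₀ h.symm hxn
      · rintro rfl
        exact hxn.symm
    rw [Finset.sum_eq_single j₀]
    · rw [if_pos ((hcond j₀ hj₀).2 rfl), hχx, hψ_def, stdAddChar_natCast, mul_add, Complex.exp_add,
        ← Complex.exp_nat_mul]
      congr 2 <;> ring
    · intro j hj hne
      rw [Finset.mem_range] at hj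
      rw [if_neg (mt (hcond j hj).1 hne)]
    · intro h
      exact absurd (Finset.mem_range.2 hj₀) h
  -- `S = g(χ, ψ)`
  have hS : (∑ x ∈ Finset.Icc 1 (p - 1), ∑ j ∈ Finset.range ℓ, if r ^ j % p = x ^ n % p then
        Complex.exp (2 * Real.pi * Complex.I * ((j : ℂ) / (ℓ : ℂ) + (x : ℂ) / (p : ℂ))) else 0) =
      gaussSum χ ψ := by
    rw [Finset.sum_congr rfl hinner, gaussSum, sum_zmod_eq_sum_range, Finset.range_eq_Ico,
      Finset.sum_eq_sum_Ico_succ_bot hp.pos, Nat.cast_zero, MulChar.map_zero, zero_mul, zero_add,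
      zero_add, ← Finset.Ico_add_one_right_eq_Icc, Nat.sub_add_cancel hp.one_le]
  rw [hS]
  constructor
  · -- `S^ℓ ∈ ℤ[ζ]`
    have hmem : gaussSum χ ψ ^ ℓ ∈ Algebra.adjoin ℤ ({ζ} : Set ℂ) := by
      rw [← hordχ, gaussSum_pow_eq_prod_jacobiSum (by omega) hψprim, hχneg, one_mul, ZMod.card]
      refine Subalgebra.mul_mem _ (Subalgebra.natCast_mem _ p) (Subalgebra.prod_mem _ fun i _ => ?_)
      exact jacobiSum_mem_algebraAdjoin_of_pow_eq_one hχℓ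
        (by rw [← pow_mul, mul_comm, pow_mul, hχℓ, one_pow]) hζ
    obtain ⟨a, ha⟩ := nf_of_mem_adjoin hℓ hζ hmem
    refine ⟨a, ?_⟩
    rw [ha]
    refine Finset.sum_congr rfl fun j _ => ?_
    rw [hζ_def, ← Complex.exp_nat_mul]
    congr 2
    ring
  · -- `‖S‖² = p`
    have h := gaussSum_mul_gaussSum_eq_card hχ1 hψprim
    rw [ZMod.card, ← star_gaussSum_eq, RCLike.star_def, Complex.mul_conj'] at h
    exact_mod_cast h

end Summit.QuantumAdvantage.QuantumAdvantage.Theorems.GaussPowerIntegral
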